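/-
b2b-lace packet, TAIL-BOUND ANALYST gen 11 (unit `b2b-lace-tail-g11`).  (S2b)-IMPR TABLE-SIDE KIT (T4): the CELL REDUCTION of the six `f₃`
cells at the true SRW tables — `∀ x ∈ 𝒳, boundHD75 (srwTrue d α̲ ᾱ) n l x r ≤ b` (`n = 0, 1`) from finitely many NODE VALUES of the plain SRW
integrals `I`, CELL SUPS of `𝒥`, `T^{(5.11)}`, `U`, `K` (the certifying modules' outputs), and ONE inequality between constants.  `d`-generic;
additive; no numeral of any dimension; nothing is a cited hypothesis — every statement is proved (order algebra on [NoBLE17] (3.71)–(3.87)).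
-/
import Literature.Probability.FitznerVanDerHofstad2017.NobleF3TrueTables
import Literature.Probability.FitznerVanDerHofstad2017.SrwIntegralIShiftCellSup
import HarnessLib

/-!
# Cell reduction of the `f₃` numerator `boundHD75` at the true SRW tables

CITATION HEADER (PLACEMENT v2). Part of a certified REPRODUCTION of R. Fitzner, R. van der Hofstad, *Generalized approach to the
non-backtracking lace expansion*, PTRF **169** (2017) 1041–1119 [NoBLE17], §3.3.5 (3.71)–(3.87) (the bounds `BoundH[i](n,l,x)` are linear in
the SRW tables with non-negative coefficients and are read as suprema over the cells `S ∈ {𝒳, {0}}`), and of R. Fitzner, R. van der Hofstad,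
*Mean-field behavior for nearest-neighbor percolation in `d > 10`*, EJP **22** (2017) no. 43 [FvdH17], §2.5 / notebook `General.nb` In[2]–In[3]:

> [NoBLE17] (3.87): "`f₃(z) ≤ max_{{n,l,S} ∈ 𝒮} sup_{x ∈ S} (Σ_{i=1}^5 BoundH[i](n,l,x)) / c_{n,l,S}`" and p. 1079: "the supremum over `S` is
> attained at one of the lowest-order points of `S`, as all involved functions are monotone decreasing in the absolute value of each coordinate".

The printed monotonicity sentence covers `𝒥`, `T`, `U`, `K` via their majorants (`MeanFieldD11FimSup`, `SrwIntegralTUCellSup`,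
`SrwIntegralSortedMonotone`); the Step-1 quantities of the true `IM` column (`I_{m+3,l}(x)`, `Σ_ι I_{m+3,l}(x ± 2e_ι)`, DIVERGENCE D80) are
reduced to nodes by `SrwIntegralIShiftCellSup`.  This module assembles the pieces into the form a certifying seat consumes.

## What is here (all proved, `d`-generic)

§1 READ-SET monotonicity of `boundHD75` at `n = 0` and `n = 1` — ACROSS tables and nodes: `boundHD75 τ 0 l v a ≤ boundHD75 τ' 0 l v' a`
   from the ten entry inequalities `τ.• m l' v ≤ τ'.• m l' v'` actually read at `(0,l)` (`IM (0,l), (0,l+1), (−1,l)`; `T (2,l), (2,l+1), (1,l)`;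
   `U (2,l), (3,l)`; `K (1,l), (2,l)`), and the twelve read at `(1,l)` (`IM (1,l), (0,l), (1,l+1), (0,l+1), (1,l+2)`; `T (3,l), (3,l+1), (2,l)`;
   `U (3,l), (4,l)`; `K (2,l), (3,l)`) — `boundHD75_zero_le_of_entries`, `boundHD75_one_le_of_entries` (refines lean2-g17's
   `F3BoundsTablesMonoAt.boundHD75_mono_at`, which asks ALL entries at one node).
§2 CONSTANT ("cell") tables `Tables.cell IMc Tc Uc Kc` and `boundHD75_cell_irrel` (node-independence, `rfl`).
§3 The node expressions `srwINode2 d n l = max (I_{n,l}(2e₁)) (I_{n,l}(e₁+e₂))` and `srwIShift2Node2 d p l` (the two entries of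
   `SrwIntegralIShiftCellSup.srwIShift2_le_max_of_mem_calX`) with `srwI_le_srwINode2_of_mem_calX`, `srwIShift2_le_srwIShift2Node2_of_mem_calX`.
§4 THE CELL THEOREMS at the true tables `srwTrue d α̲ ᾱ` (`NobleF3TrueTables`), `1 ≤ ᾱ`, `0 < α̲`, `d ≥ 9`:
   **`boundHD75_srwTrue_zero_cell_le`** (cell `(0,l)` over `𝒳`) and **`boundHD75_srwTrue_one_cell_le`** (cells `(1,l)` over `𝒳`): hypotheses =
   per read `IM (m,l')` entry: the cell sup of `𝒥_{m+2,l'}` over `𝒳` (`∀ x ∈ 𝒳, srwJ ≤ IMc m l'` — F-IM territory), the node inequalities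
   `srwINode2 d (m+3) l' ≤ d α̲ IMc m l'`, `(ᾱ−1) srwIShift2Node2 d (m+3) l' ≤ 2d² IMc m l'` (and the `m = −1` pair); per read `T`/`U`/`K`
   entry: the cell sup over `𝒳` of `srwTS d α̲`, `srwU d`, `srwK d`; and `boundHD75 (Tables.cell IMc Tc Uc Kc) n l 0 a ≤ b`.
   **`boundHD75_srwTrue_one_zero_le`**: the `x = 0` cell `(1,l)` from the twelve entry values at the origin.

## What is NOT here
No dimension, no table, no numeric value, no certificate; no statement about `d ≠` anything.
-/

noncomputable section

namespace Literature.Probability.FitznerVanDerHofstad2017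

open Finset Real
open Literature.Barriers.CriticalPhenomena Literature.Probability.LatticeModels

namespace F3Bounds

variable {ν : Type*}

/-! ### §1  Read-set monotonicity of `boundHD75` at `n = 0, 1` -/

/-- **`boundHD75` at `(0,l)` is monotone in the TEN entries it reads**, across tables and nodes.
[cite: FitznerVanDerHofstad2016NoBLE, §3.3.5 (3.71), (3.74), (3.77), (3.78), (3.86) pp. 1077–1079] -/
theorem boundHD75_zero_le_of_entries {τ τ' : Tables ν} {v v' : ν} {a : Args} (ha : a.WF) {l : ℕ}
    (hIM0 : τ.IM 0 l v ≤ τ'.IM 0 l v') (hIM0' : τ.IM 0 (l + 1) v ≤ τ'.IM 0 (l + 1) v')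
    (hIMn : τ.IM (-1) l v ≤ τ'.IM (-1) l v')
    (hT2 : τ.T 2 l v ≤ τ'.T 2 l v') (hT2' : τ.T 2 (l + 1) v ≤ τ'.T 2 (l + 1) v') (hT1 : τ.T 1 l v ≤ τ'.T 1 l v')
    (hU2 : τ.U 2 l v ≤ τ'.U 2 l v') (hU3 : τ.U 3 l v ≤ τ'.U 3 l v')
    (hK1 : τ.K 1 l v ≤ τ'.K 1 l v') (hK2 : τ.K 2 l v ≤ τ'.K 2 l v') :
    boundHD75 τ 0 l v a ≤ boundHD75 τ' 0 l v' a := by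
  have hm := m3_nonneg a
  obtain ⟨hG, hcp, haf, hafx, hap, hRp, hRfD, hRpD, hK⟩ := ha
  simp only [boundHD75, boundH1, boundH2, boundH3, boundH4D75, boundH5]
  gcongr

/-- **`boundHD75` at `(1,l)` is monotone in the TWELVE entries it reads**, across tables and nodes.
[cite: FitznerVanDerHofstad2016NoBLE, §3.3.5 (3.71), (3.74), (3.77), (3.78), (3.86) pp. 1077–1079] -/
theorem boundHD75_one_le_of_entries {τ τ' : Tables ν} {v v' : ν} {a : Args} (ha : a.WF) {l : ℕ}
    (hIM1 : τ.IM 1 l v ≤ τ'.IM 1 l v') (hIM0 : τ.IM 0 l v ≤ τ'.IM 0 l v')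
    (hIM1' : τ.IM 1 (l + 1) v ≤ τ'.IM 1 (l + 1) v') (hIM0' : τ.IM 0 (l + 1) v ≤ τ'.IM 0 (l + 1) v')
    (hIM1'' : τ.IM 1 (l + 2) v ≤ τ'.IM 1 (l + 2) v')
    (hT3 : τ.T 3 l v ≤ τ'.T 3 l v') (hT3' : τ.T 3 (l + 1) v ≤ τ'.T 3 (l + 1) v') (hT2 : τ.T 2 l v ≤ τ'.T 2 l v')
    (hU3 : τ.U 3 l v ≤ τ'.U 3 l v') (hU4 : τ.U 4 l v ≤ τ'.U 4 l v')
    (hK2 : τ.K 2 l v ≤ τ'.K 2 l v') (hK3 : τ.K 3 l v ≤ τ'.K 3 l v') :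
    boundHD75 τ 1 l v a ≤ boundHD75 τ' 1 l v' a := by
  have hm := m3_nonneg a
  obtain ⟨hG, hcp, haf, hafx, hap, hRp, hRfD, hRpD, hK⟩ := ha
  simp only [boundHD75, boundH1, boundH2, boundH3, boundH4D75, boundH5]
  gcongr

/-! ### §2  Constant (cell) tables -/

/-- The CONSTANT ("cell") tables: every node reads the cell values `IMc m l`, `Tc m l`, `Uc m l`, `Kc m l` — the reading
`sup_{x ∈ S} BoundH[i](n,l,x)` of (3.87) with each table entry replaced by its supremum over the cell `S`.
[cite: FitznerVanDerHofstad2016NoBLE, §3.3.5 (3.87) p. 1079 (cell suprema `sup_{x ∈ S}`)] -/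
def Tables.cell (IMc : ℤ → ℕ → ℝ) (Tc Uc Kc : ℕ → ℕ → ℝ) : Tables ν :=
  ⟨fun m l _ => IMc m l, fun m l _ => Tc m l, fun m l _ => Uc m l, fun m l _ => Kc m l⟩

section Cell

variable (IMc : ℤ → ℕ → ℝ) (Tc Uc Kc : ℕ → ℕ → ℝ)

/-- The `IM` column of the cell tables is the cell constant (definitional).
[cite: FitznerVanDerHofstad2016NoBLE, §3.3.5 (3.87) p. 1079 (cell suprema `sup_{x ∈ S}`)] -/
@[simp] theorem Tables.cell_IM (m : ℤ) (l : ℕ) (v : ν) : (Tables.cell IMc Tc Uc Kc : Tables ν).IM m l v = IMc m l := rfl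

/-- The `T` column of the cell tables is the cell constant (definitional).
[cite: FitznerVanDerHofstad2016NoBLE, §3.3.5 (3.87) p. 1079 (cell suprema `sup_{x ∈ S}`)] -/
@[simp] theorem Tables.cell_T (m l : ℕ) (v : ν) : (Tables.cell IMc Tc Uc Kc : Tables ν).T m l v = Tc m l := rfl

/-- The `U` column of the cell tables is the cell constant (definitional).
[cite: FitznerVanDerHofstad2016NoBLE, §3.3.5 (3.87) p. 1079 (cell suprema `sup_{x ∈ S}`)] -/
@[simp] theorem Tables.cell_U (m l : ℕ) (v : ν) : (Tables.cell IMc Tc Uc Kc : Tables ν).U m l v = Uc m l := rfl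

/-- The `K` column of the cell tables is the cell constant (definitional).
[cite: FitznerVanDerHofstad2016NoBLE, §3.3.5 (3.87) p. 1079 (cell suprema `sup_{x ∈ S}`)] -/
@[simp] theorem Tables.cell_K (m l : ℕ) (v : ν) : (Tables.cell IMc Tc Uc Kc : Tables ν).K m l v = Kc m l := rfl

/-- `boundHD75` of the cell tables does not depend on the node: `sup_{x ∈ S} Σ_i BoundH[i](n,l,x)` read entrywise is ONE number per
cell (definitional). [cite: FitznerVanDerHofstad2016NoBLE, §3.3.5 (3.87) p. 1079 (cell suprema `sup_{x ∈ S}`)] -/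
theorem boundHD75_cell_irrel (n l : ℕ) (v w : ν) (a : Args) :
    boundHD75 (Tables.cell IMc Tc Uc Kc : Tables ν) n l v a = boundHD75 (Tables.cell IMc Tc Uc Kc) n l w a := rfl

end Cell

/-! ### §3  The node expressions of the Step-1 quantities on `𝒳` -/

variable {d : ℕ}

/-- `max (I_{n,l}(2e₁)) (I_{n,l}(e₁+e₂))` — the two lowest-order points of `{‖x‖₁ ≥ 2}`.
[cite: FitznerVanDerHofstad2016NoBLE, §3.3.5 p. 1079 ("lowest-order points of `S`"); Lemma 5.1 p. 1093] -/
def srwINode2 (d n l : ℕ) : ℝ := max (srwI d n l (vecOfParts d [2])) (srwI d n l (classVec d 2 0))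

/-- The two-entry node expression bounding the shift sum `S_{p,l}` on `{‖x‖₁ ≥ 2}` (`SrwIntegralIShiftCellSup`).
[cite: FitznerVanDerHofstad2016NoBLE, (3.30) p. 1070; §3.3.5 p. 1079; Lemma 5.1 p. 1093] -/
def srwIShift2Node2 (d p l : ℕ) : ℝ :=
  max (srwI d p l 0 + srwI d p l (vecOfParts d [4]) + (2 * d - 2) * srwI d p l (vecOfParts d [2, 2]))
    (4 * srwI d p l (vecOfParts d [1]) + (2 * d - 4) * srwI d p l (classVec d 2 0))

/-- `I_{n,l}(x) ≤ srwINode2 d n l` on `𝒳` (`n ≥ 1`, `d ≥ 2n+1`). [cite: FitznerVanDerHofstad2016NoBLE, Lemma 5.1 p. 1093] -/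
theorem srwI_le_srwINode2_of_mem_calX {n : ℕ} (hn : 1 ≤ n) (hd : 2 * n + 1 ≤ d) (l : ℕ) {x : Fin d → ℤ}
    (hx : x ∈ calX d) : srwI d n l x ≤ srwINode2 d n l :=
  srwI_le_max_of_mem_calX hn hd l hx

/-- `S_{p,l}(x) ≤ srwIShift2Node2 d p l` on `𝒳` (`p ≥ 1`, `d ≥ 2p+1`). [cite: FitznerVanDerHofstad2016NoBLE, (3.30); Lemma 5.1 p. 1093] -/
theorem srwIShift2_le_srwIShift2Node2_of_mem_calX {p : ℕ} (hp : 1 ≤ p) (hd : 2 * p + 1 ≤ d) (l : ℕ)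
    {x : Fin d → ℤ} (hx : x ∈ calX d) : srwIShift2 d p l x ≤ srwIShift2Node2 d p l :=
  srwIShift2_le_max_of_mem_calX hp hd l hx

/-! ### §4  The cells at the true tables -/

section TrueCells

variable {afmin afmax : ℝ}

/-- One natural-row `IM` entry of the true tables on `𝒳` from the cell sup of `𝒥` and the node inequalities (`m + 3 ≥ 1`, `d ≥ 2m+7`).
[cite: FitznerVanDerHofstad2016NoBLE, §3.3.5 (3.58), (3.30), p. 1079; Lemma 5.1 p. 1093] -/
theorem srwTrue_IM_natCast_le_of_cell (hα : 0 < afmin) (hᾱ : 1 ≤ afmax) {m l : ℕ} (hd : 2 * (m + 3) + 1 ≤ d) {t : ℝ}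
    (hJ : ∀ x ∈ calX d, srwJ d (m + 2) l x ≤ t) (hI : srwINode2 d (m + 3) l ≤ d * afmin * t)
    (hS : (afmax - 1) * srwIShift2Node2 d (m + 3) l ≤ 2 * (d : ℝ) ^ 2 * t)
    {x : Fin d → ℤ} (hx : x ∈ calX d) : (srwTrue d afmin afmax).IM m l x ≤ t :=
  srwTrue_IM_natCast_le (by omega) hα (hJ x hx)
    ((srwI_le_srwINode2_of_mem_calX (by omega) hd l hx).trans hI)
    ((mul_le_mul_of_nonneg_left (srwIShift2_le_srwIShift2Node2_of_mem_calX (by omega) hd l hx) (by linarith)).trans hS)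

/-- The `m = −1` `IM` entry of the true tables on `𝒳` from the node inequalities (`d ≥ 5`).
[cite: FitznerVanDerHofstad2016NoBLE, §3.3.5 (3.61) p. 1074, (3.30) p. 1070, p. 1079; Lemma 5.1 p. 1093] -/
theorem srwTrue_IM_negOne_le_of_cell (hα : 0 < afmin) (hd : 5 ≤ d) {l : ℕ} {t : ℝ}
    (h1 : srwINode2 d 1 (l + 1) + srwIShift2Node2 d 2 l / (2 * (d : ℝ) ^ 2 * afmin) ≤ t)
    (h2 : srwINode2 d 2 l ≤ d * afmin * t)
    {x : Fin d → ℤ} (hx : x ∈ calX d) : (srwTrue d afmin afmax).IM (-1) l x ≤ t := by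
  have hdpos : (0 : ℝ) < d := Nat.cast_pos.mpr (by omega)
  refine srwTrue_IM_negOne_le (by omega) hα (le_trans (add_le_add ?_ ?_) h1)
    ((srwI_le_srwINode2_of_mem_calX (by norm_num) (by omega) l hx).trans h2)
  · exact srwI_le_srwINode2_of_mem_calX (by norm_num) (by omega) (l + 1) hx
  · exact div_le_div_of_nonneg_right (srwIShift2_le_srwIShift2Node2_of_mem_calX (by norm_num) (by omega) l hx)
      (by positivity)

/-- **The cell `(0,l)` over `𝒳` at the true tables.**  From: the cell sups of `𝒥_{2,l}`, `𝒥_{2,l+1}` over `𝒳`; the node inequalities for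
`I_{3,l}`, `S_{3,l}`, `I_{3,l+1}`, `S_{3,l+1}` and for the `m = −1` row (`I_{1,l+1} + S_{2,l}/(2d²α̲)`, `I_{2,l}`); the cell sups over `𝒳` of
`T^{(5.11)}_{2,l}, T^{(5.11)}_{2,l+1}, T^{(5.11)}_{1,l}` (`srwTS d α̲`), `U_{2,l}, U_{3,l}`, `K_{1,l}, K_{2,l}`; and the constant inequality
`boundHD75 (Tables.cell IMc Tc Uc Kc) 0 l 0 a ≤ b` — conclude `boundHD75 (srwTrue d α̲ ᾱ) 0 l x a ≤ b` for every `x ∈ 𝒳`.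
[cite: FitznerVanDerHofstad2016NoBLE, §3.3.5 (3.87) p. 1079; (3.71)–(3.86)] [cite: FitznerVanDerHofstad2017, §2.5; notebook General.nb In[2]–In[3]] -/
theorem boundHD75_srwTrue_zero_cell_le (hd : 9 ≤ d) (hα : 0 < afmin) (hᾱ : 1 ≤ afmax) {a : Args} (ha : a.WF)
    {IMc : ℤ → ℕ → ℝ} {Tc Uc Kc : ℕ → ℕ → ℝ} {l : ℕ} {b : ℝ}
    (hJ0 : ∀ x ∈ calX d, srwJ d 2 l x ≤ IMc 0 l) (hI0 : srwINode2 d 3 l ≤ d * afmin * IMc 0 l)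
    (hS0 : (afmax - 1) * srwIShift2Node2 d 3 l ≤ 2 * (d : ℝ) ^ 2 * IMc 0 l)
    (hJ0' : ∀ x ∈ calX d, srwJ d 2 (l + 1) x ≤ IMc 0 (l + 1)) (hI0' : srwINode2 d 3 (l + 1) ≤ d * afmin * IMc 0 (l + 1))
    (hS0' : (afmax - 1) * srwIShift2Node2 d 3 (l + 1) ≤ 2 * (d : ℝ) ^ 2 * IMc 0 (l + 1))
    (hN1 : srwINode2 d 1 (l + 1) + srwIShift2Node2 d 2 l / (2 * (d : ℝ) ^ 2 * afmin) ≤ IMc (-1) l)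
    (hN2 : srwINode2 d 2 l ≤ d * afmin * IMc (-1) l)
    (hT2 : ∀ x ∈ calX d, srwTS d afmin 2 l x ≤ Tc 2 l) (hT2' : ∀ x ∈ calX d, srwTS d afmin 2 (l + 1) x ≤ Tc 2 (l + 1))
    (hT1 : ∀ x ∈ calX d, srwTS d afmin 1 l x ≤ Tc 1 l)
    (hU2 : ∀ x ∈ calX d, srwU d 2 l x ≤ Uc 2 l) (hU3 : ∀ x ∈ calX d, srwU d 3 l x ≤ Uc 3 l)
    (hK1 : ∀ x ∈ calX d, srwK d 1 l x ≤ Kc 1 l) (hK2 : ∀ x ∈ calX d, srwK d 2 l x ≤ Kc 2 l)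
    (hnum : boundHD75 (Tables.cell IMc Tc Uc Kc : Tables (Fin d → ℤ)) 0 l 0 a ≤ b) :
    ∀ x ∈ calX d, boundHD75 (srwTrue d afmin afmax) 0 l x a ≤ b := by
  intro x hx
  refine le_trans ?_ ((boundHD75_cell_irrel IMc Tc Uc Kc 0 l x 0 a).le.trans hnum)
  exact boundHD75_zero_le_of_entries ha
    (srwTrue_IM_natCast_le_of_cell hα hᾱ (by omega) hJ0 hI0 hS0 hx)
    (srwTrue_IM_natCast_le_of_cell hα hᾱ (by omega) hJ0' hI0' hS0' hx)
    (srwTrue_IM_negOne_le_of_cell hα (by omega) hN1 hN2 hx)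
    (hT2 x hx) (hT2' x hx) (hT1 x hx) (hU2 x hx) (hU3 x hx) (hK1 x hx) (hK2 x hx)

/-- **The cells `(1,l)` over `𝒳` at the true tables.**  From: the cell sups of `𝒥_{3,l}, 𝒥_{2,l}, 𝒥_{3,l+1}, 𝒥_{2,l+1}, 𝒥_{3,l+2}` over `𝒳`;
the node inequalities for `I_{4,·}, S_{4,·}` (rows `m = 1`) and `I_{3,·}, S_{3,·}` (rows `m = 0`) at the same `l'`; the cell sups over `𝒳` of
`T^{(5.11)}_{3,l}, T^{(5.11)}_{3,l+1}, T^{(5.11)}_{2,l}`, `U_{3,l}, U_{4,l}`, `K_{2,l}, K_{3,l}`; and `boundHD75 (Tables.cell IMc Tc Uc Kc) 1 l 0 a ≤ b` —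
conclude `boundHD75 (srwTrue d α̲ ᾱ) 1 l x a ≤ b` for every `x ∈ 𝒳`.
[cite: FitznerVanDerHofstad2016NoBLE, §3.3.5 (3.87) p. 1079; (3.71)–(3.86)] [cite: FitznerVanDerHofstad2017, §2.5; notebook General.nb In[2]–In[3]] -/
theorem boundHD75_srwTrue_one_cell_le (hd : 9 ≤ d) (hα : 0 < afmin) (hᾱ : 1 ≤ afmax) {a : Args} (ha : a.WF)
    {IMc : ℤ → ℕ → ℝ} {Tc Uc Kc : ℕ → ℕ → ℝ} {l : ℕ} {b : ℝ}
    (hJ1 : ∀ x ∈ calX d, srwJ d 3 l x ≤ IMc 1 l) (hI1 : srwINode2 d 4 l ≤ d * afmin * IMc 1 l)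
    (hS1 : (afmax - 1) * srwIShift2Node2 d 4 l ≤ 2 * (d : ℝ) ^ 2 * IMc 1 l)
    (hJ0 : ∀ x ∈ calX d, srwJ d 2 l x ≤ IMc 0 l) (hI0 : srwINode2 d 3 l ≤ d * afmin * IMc 0 l)
    (hS0 : (afmax - 1) * srwIShift2Node2 d 3 l ≤ 2 * (d : ℝ) ^ 2 * IMc 0 l)
    (hJ1' : ∀ x ∈ calX d, srwJ d 3 (l + 1) x ≤ IMc 1 (l + 1)) (hI1' : srwINode2 d 4 (l + 1) ≤ d * afmin * IMc 1 (l + 1))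
    (hS1' : (afmax - 1) * srwIShift2Node2 d 4 (l + 1) ≤ 2 * (d : ℝ) ^ 2 * IMc 1 (l + 1))
    (hJ0' : ∀ x ∈ calX d, srwJ d 2 (l + 1) x ≤ IMc 0 (l + 1)) (hI0' : srwINode2 d 3 (l + 1) ≤ d * afmin * IMc 0 (l + 1))
    (hS0' : (afmax - 1) * srwIShift2Node2 d 3 (l + 1) ≤ 2 * (d : ℝ) ^ 2 * IMc 0 (l + 1))
    (hJ1'' : ∀ x ∈ calX d, srwJ d 3 (l + 2) x ≤ IMc 1 (l + 2)) (hI1'' : srwINode2 d 4 (l + 2) ≤ d * afmin * IMc 1 (l + 2))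
    (hS1'' : (afmax - 1) * srwIShift2Node2 d 4 (l + 2) ≤ 2 * (d : ℝ) ^ 2 * IMc 1 (l + 2))
    (hT3 : ∀ x ∈ calX d, srwTS d afmin 3 l x ≤ Tc 3 l) (hT3' : ∀ x ∈ calX d, srwTS d afmin 3 (l + 1) x ≤ Tc 3 (l + 1))
    (hT2 : ∀ x ∈ calX d, srwTS d afmin 2 l x ≤ Tc 2 l)
    (hU3 : ∀ x ∈ calX d, srwU d 3 l x ≤ Uc 3 l) (hU4 : ∀ x ∈ calX d, srwU d 4 l x ≤ Uc 4 l)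
    (hK2 : ∀ x ∈ calX d, srwK d 2 l x ≤ Kc 2 l) (hK3 : ∀ x ∈ calX d, srwK d 3 l x ≤ Kc 3 l)
    (hnum : boundHD75 (Tables.cell IMc Tc Uc Kc : Tables (Fin d → ℤ)) 1 l 0 a ≤ b) :
    ∀ x ∈ calX d, boundHD75 (srwTrue d afmin afmax) 1 l x a ≤ b := by
  intro x hx
  refine le_trans ?_ ((boundHD75_cell_irrel IMc Tc Uc Kc 1 l x 0 a).le.trans hnum)
  exact boundHD75_one_le_of_entries ha
    (srwTrue_IM_natCast_le_of_cell hα hᾱ (by omega) hJ1 hI1 hS1 hx)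
    (srwTrue_IM_natCast_le_of_cell hα hᾱ (by omega) hJ0 hI0 hS0 hx)
    (srwTrue_IM_natCast_le_of_cell hα hᾱ (by omega) hJ1' hI1' hS1' hx)
    (srwTrue_IM_natCast_le_of_cell hα hᾱ (by omega) hJ0' hI0' hS0' hx)
    (srwTrue_IM_natCast_le_of_cell hα hᾱ (by omega) hJ1'' hI1'' hS1'' hx)
    (hT3 x hx) (hT3' x hx) (hT2 x hx) (hU3 x hx) (hU4 x hx) (hK2 x hx) (hK3 x hx)

/-- **The `x = 0` cell `(1,l)` at the true tables** from the twelve entry values AT THE ORIGIN (no sup step): per natural row the three origin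
inequalities `𝒥_{m+2,l'}(0) ≤ IMc`, `I_{m+3,l'}(0) ≤ dα̲·IMc`, `(ᾱ−1)·2d·I_{m+3,l'}(2e₁) ≤ 2d²·IMc` (`S_{p,l'}(0) = 2d I_{p,l'}(2e₁)`), the
origin values of `T^{(5.11)}`, `U`, `K`, and `boundHD75 (Tables.cell IMc Tc Uc Kc) 1 l 0 a ≤ b`.
[cite: FitznerVanDerHofstad2016NoBLE, §3.3.5 (3.87) p. 1079 (cell `{0}`); (3.30), (3.35)] [cite: FitznerVanDerHofstad2017, §2.5] -/
theorem boundHD75_srwTrue_one_zero_le (hd : 1 ≤ d) (hα : 0 < afmin) {a : Args} (ha : a.WF)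
    {IMc : ℤ → ℕ → ℝ} {Tc Uc Kc : ℕ → ℕ → ℝ} {l : ℕ} {b : ℝ}
    (hJ1 : srwJ d 3 l 0 ≤ IMc 1 l) (hI1 : srwI d 4 l 0 ≤ d * afmin * IMc 1 l)
    (hS1 : (afmax - 1) * (2 * d * srwI d 4 l (vecOfParts d [2])) ≤ 2 * (d : ℝ) ^ 2 * IMc 1 l)
    (hJ0 : srwJ d 2 l 0 ≤ IMc 0 l) (hI0 : srwI d 3 l 0 ≤ d * afmin * IMc 0 l)
    (hS0 : (afmax - 1) * (2 * d * srwI d 3 l (vecOfParts d [2])) ≤ 2 * (d : ℝ) ^ 2 * IMc 0 l)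
    (hJ1' : srwJ d 3 (l + 1) 0 ≤ IMc 1 (l + 1)) (hI1' : srwI d 4 (l + 1) 0 ≤ d * afmin * IMc 1 (l + 1))
    (hS1' : (afmax - 1) * (2 * d * srwI d 4 (l + 1) (vecOfParts d [2])) ≤ 2 * (d : ℝ) ^ 2 * IMc 1 (l + 1))
    (hJ0' : srwJ d 2 (l + 1) 0 ≤ IMc 0 (l + 1)) (hI0' : srwI d 3 (l + 1) 0 ≤ d * afmin * IMc 0 (l + 1))
    (hS0' : (afmax - 1) * (2 * d * srwI d 3 (l + 1) (vecOfParts d [2])) ≤ 2 * (d : ℝ) ^ 2 * IMc 0 (l + 1))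
    (hJ1'' : srwJ d 3 (l + 2) 0 ≤ IMc 1 (l + 2)) (hI1'' : srwI d 4 (l + 2) 0 ≤ d * afmin * IMc 1 (l + 2))
    (hS1'' : (afmax - 1) * (2 * d * srwI d 4 (l + 2) (vecOfParts d [2])) ≤ 2 * (d : ℝ) ^ 2 * IMc 1 (l + 2))
    (hT3 : srwTS d afmin 3 l 0 ≤ Tc 3 l) (hT3' : srwTS d afmin 3 (l + 1) 0 ≤ Tc 3 (l + 1)) (hT2 : srwTS d afmin 2 l 0 ≤ Tc 2 l)
    (hU3 : srwU d 3 l 0 ≤ Uc 3 l) (hU4 : srwU d 4 l 0 ≤ Uc 4 l) (hK2 : srwK d 2 l 0 ≤ Kc 2 l) (hK3 : srwK d 3 l 0 ≤ Kc 3 l)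
    (hnum : boundHD75 (Tables.cell IMc Tc Uc Kc : Tables (Fin d → ℤ)) 1 l 0 a ≤ b) :
    boundHD75 (srwTrue d afmin afmax) 1 l 0 a ≤ b := by
  have hrow : ∀ {m l' : ℕ} {t : ℝ}, srwJ d (m + 2) l' 0 ≤ t → srwI d (m + 3) l' 0 ≤ d * afmin * t →
      (afmax - 1) * (2 * d * srwI d (m + 3) l' (vecOfParts d [2])) ≤ 2 * (d : ℝ) ^ 2 * t →
      (srwTrue d afmin afmax).IM m l' 0 ≤ t := fun hJ hI hS =>
    srwTrue_IM_natCast_le hd hα hJ hI (by rwa [srwIShift2_zero _ _ hd])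
  refine le_trans ?_ hnum
  exact boundHD75_one_le_of_entries ha (hrow hJ1 hI1 hS1) (hrow hJ0 hI0 hS0) (hrow hJ1' hI1' hS1') (hrow hJ0' hI0' hS0')
    (hrow hJ1'' hI1'' hS1'') hT3 hT3' hT2 hU3 hU4 hK2 hK3

end TrueCells

end F3Bounds

end Literature.Probability.FitznerVanDerHofstad2017

end
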